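import Summits.Ventures.PackingBounds.ThreePointCert.C16QProof
import Summits.Ventures.PackingBounds.Configurations.KerdockCode16

/-!
# `A(16, arccos 1/4) = 288` in the kernel (the Kerdock / Nordstrom–Robinson code is an optimal spherical code)

Framing: lottery ticket; floor = certified bounds/negative ranges. Venture `PackingBounds` (cell
`pub-packcert`, seat `pub-packcert-lp`), B2c grid cell `(16, 1/4)`.

Two kernel-checked halves: the upper bound `ThreePointCert.C16Q.code_dim16_quarter_le_288_sdp` (an exact
Bachoc–Vallentin three-point certificate of degree `8`, bound value `288.012490`, cell certificate
`sdp-d16-deg8-s14-sym2-lp-v1.json`) and the attained side `Config.KerdockCode16.exists_code_288` (the `288`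
vectors of the `9` real mutually unbiased bases of `ℝ¹⁶`). The theorem itself — optimality of the `288`-point
Kerdock spherical code — is due to Cohn, de Laat and Leijenhorst (2024), who proved it (with universal optimality and
uniqueness) by an exact three-point bound; this file is an independent formal verification of the optimality
statement, not a new result.

## References
* H. Cohn, D. de Laat, N. Leijenhorst, *Optimality of spherical codes via exact semidefinite programming bounds*,
  arXiv:2403.16874 (2024), Theorem 1.1. [`CohnDelaatLeijenhorst2024`]
* C. Bachoc, F. Vallentin, *New upper bounds for kissing numbers from semidefinite programming*,
  J. Amer. Math. Soc. 21 (2008) 909–924. [`BachocVallentin2007`]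
-/

namespace Summit.Ventures.PackingBounds.SphericalCodes

/-- **`A(16, arccos 1/4) = 288`**: the largest number of unit vectors of `ℝ¹⁶` with pairwise inner products
`≤ 1/4` is `288` (attained by the Kerdock / Nordstrom–Robinson code; upper bound by a kernel-checked exact
three-point certificate). [cite: CohnDelaatLeijenhorst2024, Theorem 1.1] -/
theorem code_dim16_quarter_isGreatest :
    IsGreatest {N : ℕ | ∃ C : Finset (EuclideanSpace ℝ (Fin 16)), C.card = N ∧ (∀ x ∈ C, ‖x‖ = 1) ∧
      (∀ x ∈ C, ∀ y ∈ C, x ≠ y → inner ℝ x y ≤ 1 / 4)} 288 := by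
  refine ⟨Config.KerdockCode16.exists_code_288, ?_⟩
  rintro N ⟨C, rfl, h1, h2⟩
  exact ThreePointCert.C16Q.code_dim16_quarter_le_288_sdp C h1 h2

/-- Pointwise form: every spherical code of `ℝ¹⁶` with pairwise inner products `≤ 1/4` has at most `288` points,
and `288` is attained. [cite: CohnDelaatLeijenhorst2024, Theorem 1.1] -/
theorem code_dim16_quarter_eq :
    (∃ C : Finset (EuclideanSpace ℝ (Fin 16)), C.card = 288 ∧ (∀ x ∈ C, ‖x‖ = 1) ∧
      (∀ x ∈ C, ∀ y ∈ C, x ≠ y → inner ℝ x y ≤ 1 / 4)) ∧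
    ∀ C : Finset (EuclideanSpace ℝ (Fin 16)), (∀ x ∈ C, ‖x‖ = 1) →
      (∀ x ∈ C, ∀ y ∈ C, x ≠ y → inner ℝ x y ≤ 1 / 4) → C.card ≤ 288 :=
  ⟨Config.KerdockCode16.exists_code_288, ThreePointCert.C16Q.code_dim16_quarter_le_288_sdp⟩

end Summit.Ventures.PackingBounds.SphericalCodes
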